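import Mathlib.MeasureTheory.Integral.IntervalIntegral.Basic
import Literature.Probability.RandomPlanarGeometry.SLEKappaRhoRestriction
import Literature.Probability.RandomPlanarGeometry.SLEKappaRhoMartingaleAlgebra
import Literature.Probability.RandomPlanarGeometry.StarHullCanonical
import HarnessLib

/-!
# [LSW] §8.4: the one-sided martingale `M_t` as a deterministic functional, and the conclusion of Lemma 8.9 as a predicate

First file of the decomposition of the named fact
`Literature.Probability.RandomPlanarGeometry.SLEKappaRho.exists_isOneSidedMartingale`
(`SLEKappaRhoRestriction`: for `ρ > −2`, an SLE(8/3, ρ) driving pair `(O, W)` and a smooth hull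
`A ∈ 𝒬₊` there is a process with the properties `SLEKappaRho.IsOneSidedMartingale ρ A W M`), after

* G. F. Lawler, O. Schramm, W. Werner, *Conformal restriction: the chordal case*, J. Amer. Math.
  Soc. **16** (2003) 917–955, arXiv:math/0209343 (**[LSW]**), §8.4 "Proof of Theorem 8.4":
  "Fix `ρ > −2` and let `c = 3ρ/8` and `b = ρ(4 + 3ρ)/32`. […] Let `A ∈ 𝒬₊` be a given smooth
  hull, and let `Φ = Φ_A`, `T = T_A`, and `h_t` be as in §5 and define (for `t < T`),
  `M_t := h_t'(W_t)^{5/8} h_t'(O_t)^b [(h_t(W_t) − h_t(O_t))/(W_t − O_t)]^c`. Of course, when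
  `W_t = O_t`, we take `M_t = h_t'(W_t)^{(5/8)+b+c}`. **Lemma 8.9.** `(M_t, t < T)` is a local
  martingale. **Lemma 8.10.** There exists `ε > 0` such that `M_t ≤ h_t'(W_t)^ε` for all `t < T`.
  In particular, `M_t ≤ 1`."; end of the proof of Thm. 8.4: "since `M_t` converges a.s. and in
  `L¹` when `t → T` […]".

Here `h_t = g_{g_t(A)}` (§5), so that in the vocabulary of the tree — the slid hull
`B = A_t − W_t = (g_t − W_t)(A)` (`Loewner.slidHull`) and the numbers `Φ'_B(0)` of `RestrictionHulls`
(`HasRestrictionDeriv`) — `h_t'(W_t) = Φ'_B(0)`, `h_t'(O_t) = Φ'_{B − o}(0)` with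
`o = O_t − W_t ≤ 0` (the hull seen from `O_t`), and, by the fundamental theorem of calculus,
`(h_t(W_t) − h_t(O_t))/(W_t − O_t) = ⨍_{[o, 0]} Φ'_{B − x}(0) dx` (`h_t'(x + W_t) = Φ'_{B − x}(0)`).
Contents (definitions and proved API only; no named facts):

* `hullDeriv B` — the number `Φ'_B(0) ∈ (0, 1]` of a `*`-hull `B` as a real-valued function of
  the set `B` (the unique `d` with `HasRestrictionDeriv B Φ_B d`, by the PROVED existence and
  uniqueness `IsStarHull.existsUnique_isRestrictionMap_holds`,
  `IsStarHull.exists_hasRestrictionDeriv_holds`; junk value `1` off `𝒬*`), with its API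
  (`hullDeriv_eq`: it is `e` for any restriction data `(Ψ, e)`);
* `SLEKappaRho.translate B x = B − x`, `SLEKappaRho.hullSlope B o`
  (`= (h(W) − h(O))/(W − O)` in slid coordinates) and
  `SLEKappaRho.oneSidedM ρ B o = Φ'_B(0)^{5/8} Φ'_{B−o}(0)^b (hullSlope B o)^c` — the
  DETERMINISTIC functional of which `M_t` is the value at `(A_t − W_t, O_t − W_t)`, with the
  printed convention `M = h'^{5/8 + b + c} = h'^α` at `o = 0` (`oneSidedM_zero`);
* `SLEKappaRho.IsMartingaleExtension ρ A O W M` — the CONCLUSION of Lemma 8.9 with the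
  convergence clause, as a predicate: `M` is a `[0, 1]`-valued `𝓕ᵂ`-martingale equal to the
  formula before `T_A`, frozen after `T_A`, convergent on `{T_A = ∞}` (the packaging of
  `sle_exists_isRestrictionMartingale`, [LSW] Prop. 5.2/5.3, `SLERestrictionMartingale`);
  non-vacuity `isMartingaleExtension_empty`.

* `hullDeriv_eq_starDeriv` — `hullDeriv` agrees with the canonical restriction derivative
  `starDeriv` of `StarHullCanonical` (uniqueness of `Φ_B` and of `Φ'_B(0)`), so that the one-step
  expansions of `StarHullOneStep`/`StarHullCanonical` and the continuity results of
  `RestrictionDerivTime` apply to the factors of `oneSidedM` verbatim.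

The algebra of both lemmas (the vanishing of the drift of `dM_t/M_t`; the quadratic form of the
proof of Lemma 8.10) is PROVED in `SLEKappaRhoMartingaleAlgebra`.

Status of the decomposition (review of 2026-08-15, D-0026): `SLEKappaRho.exists_isOneSidedMartingale`
is a decomposition child of `SLEKappaRho.measure_fill_disjoint` ([LSW] Thm. 8.4) and is NOT
decomposed further — in particular the existence of a martingale extension (Lemma 8.9) is NOT
recorded as a named fact; `IsMartingaleExtension` is only a predicate. The fact is faithful to the
printed Lemmas 8.9, 8.10, (8.2) and the convergence sentence of the end of the proof of Thm. 8.4,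
and is to be PROVED inline, along the lines of the tree's proof of the SLE_{8/3} analogue
`sle_exists_isRestrictionMartingale` ([LSW] Prop. 5.2/5.3; `SLERestrictionProcesses`,
`SLERestrictionOneStep`, `SLERestrictionIncrement`, `SLERestrictionLocalMartingale`,
`SLERestrictionConvergence`, `SLERestrictionMartingaleExists`): (1) Lemma 8.10 with (8.2) is
deterministic — the slid hull `A_t − W_t` of a smooth `A ∈ 𝒬₊` is an arc hull, generated by the
Loewner chain of a continuous driving function (`IsArcHull.exists_loewner_chain_holds`,
`LoewnerSlitTheorem`), along which `log g_s'(x) = −∫ 2 ds/(g_s(x) − U_s)²` at real points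
(`LoewnerRealKoebe`, `LoewnerReflection`) gives the representation (8.3), concluded by
`SLEKappaRho.quadForm_ge` / `quadForm_le`; (2) Lemma 8.9 by conditional increments over a partition,
with the deterministic one-step expansions of the three factors (jets of `LoewnerImageStepJet`), the
independence of the Brownian increments from the past at fixed times, a regular version of the
driving pair (`SLEKappaRho.RegularPair`), and the algebra `SLEKappaRho.itoDriftRatio_eq_zero`
read as `P/Z + H = 0` — `P = M (ρ ∂_W − 2 ∂_O) log M` collecting the terms driven by the
finite-variation parts `ρ ∫ ds/Z`, `O = −2 ∫ ds/Z`, `H` the `dt`-rate terms — so that the drift of a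
cell `[u, u + h]` is `(P_u/Z_u) ∫_u^{u+h} (Z_u − Z_r) dr/Z_r`, where `P/Z` stays bounded up to the
diagonal `W = O` (the poles of `(ρ ∂_W − 2 ∂_O) log M` cancel there for `b = ρ(4 + 3ρ)/32`,
`c = 3ρ/8`; expand in the coordinates `h'(W)`, `h'(O)` and the slope
`∫₀¹ h'(O + θ(W − O)) dθ`, which are smooth up to the diagonal), and the sum over cells vanishes
with the mesh by dominated convergence under the localisation `∫₀ᵗ ds/Z_s ≤ n`; no Markov property
of the pair `(O, W)` and no Itô formula for random functions is required.
-/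
noncomputable section

open Set Filter MeasureTheory
open scoped NNReal ENNReal Topology
open UpperHalfPlane (upperHalfPlaneSet)
open Literature.Probability.Process (preWienerMeasure)

namespace Literature.Probability.RandomPlanarGeometry

/-! ### `Φ'_B(0)` as a function of the hull -/

open Classical in
/-- **The number `Φ'_B(0)` of a `*`-hull `B`** ([LSW] §2 p. 8 and (2.4): `Φ_B = g_B − g_B(0)`,
`0 < Φ_B'(0) ≤ 1`), as a real-valued function of the set `B`: for `B ∈ 𝒬*` the (unique) number
`d` with `HasRestrictionDeriv B Φ d` for the (unique) restriction map `Φ` of `B`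
(`IsStarHull.existsUnique_isRestrictionMap_holds`, `IsStarHull.exists_hasRestrictionDeriv_holds`,
both proved in the tree); the documented junk value `1 = Φ'_∅(0)` when `B ∉ 𝒬*`.
[cite: LawlerSchrammWerner2003Restriction, §2 p. 8 (Φ_A) with (2.4) p. 7] -/
def hullDeriv (B : Set ℂ) : ℝ :=
  if h : IsStarHull B then
    Classical.choose (IsStarHull.exists_hasRestrictionDeriv_holds h
      (Classical.choose_spec (IsStarHull.existsUnique_isRestrictionMap_holds h)).1)
  else 1

section HullDeriv

variable {B : Set ℂ}

/-- For a `*`-hull, `hullDeriv B` is `Φ'_B(0)` for some restriction map of `B`, and lies in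
`(0, 1]`. [folklore] -/
theorem exists_hasRestrictionDeriv_hullDeriv (hB : IsStarHull B) :
    ∃ Φ : ConformalEquiv (upperHalfPlaneSet \ B) upperHalfPlaneSet, IsRestrictionMap B Φ ∧
      HasRestrictionDeriv B Φ (hullDeriv B) ∧ 0 < hullDeriv B ∧ hullDeriv B ≤ 1 := by
  classical
  rw [hullDeriv, dif_pos hB]
  set Φ := Classical.choose (IsStarHull.existsUnique_isRestrictionMap_holds hB) with hΦ
  have hΦr : IsRestrictionMap B Φ := (Classical.choose_spec (IsStarHull.existsUnique_isRestrictionMap_holds hB)).1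
  have hspec := Classical.choose_spec (IsStarHull.exists_hasRestrictionDeriv_holds hB hΦr)
  exact ⟨Φ, hΦr, hspec.2.2, hspec.1, hspec.2.1⟩

/-- **`hullDeriv B = Φ'_B(0)`** for every restriction map of a `*`-hull `B` (uniqueness of `Φ_B`
and of the limit defining `Φ'_B(0)`). [folklore] -/
theorem hullDeriv_eq (hB : IsStarHull B) {Ψ : ConformalEquiv (upperHalfPlaneSet \ B) upperHalfPlaneSet}
    (hΨ : IsRestrictionMap B Ψ) {e : ℝ} (he : HasRestrictionDeriv B Ψ e) : hullDeriv B = e := by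
  obtain ⟨Φ, hΦ, hd, -, -⟩ := exists_hasRestrictionDeriv_hullDeriv hB
  exact (HasRestrictionDeriv.eq_of_isRestrictionMap IsStarHull.existsUnique_isRestrictionMap_holds
    hB hΦ hΨ hd he).symm

/-- Off `𝒬*` the junk value is `1`. [folklore] -/
theorem hullDeriv_of_not_isStarHull (hB : ¬ IsStarHull B) : hullDeriv B = 1 := by
  classical
  rw [hullDeriv, dif_neg hB]

/-- `0 < hullDeriv B` ([LSW] (2.4) for `*`-hulls; the junk value is `1`). [folklore] -/
theorem hullDeriv_pos (B : Set ℂ) : 0 < hullDeriv B := by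
  by_cases hB : IsStarHull B
  · exact (exists_hasRestrictionDeriv_hullDeriv hB).choose_spec.2.2.1
  · rw [hullDeriv_of_not_isStarHull hB]; exact one_pos

/-- `hullDeriv B ≤ 1` ([LSW] (2.4) for `*`-hulls; the junk value is `1`). [folklore] -/
theorem hullDeriv_le_one (B : Set ℂ) : hullDeriv B ≤ 1 := by
  by_cases hB : IsStarHull B
  · exact (exists_hasRestrictionDeriv_hullDeriv hB).choose_spec.2.2.2
  · rw [hullDeriv_of_not_isStarHull hB]

/-- `Φ'_∅(0) = 1`. [folklore] -/
theorem hullDeriv_empty : hullDeriv (∅ : Set ℂ) = 1 :=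
  hullDeriv_eq isStarHull_empty isRestrictionMap_empty hasRestrictionDeriv_empty

/-- Real powers of `hullDeriv B` with positive exponent lie in `(0, 1]`. [folklore] -/
theorem hullDeriv_rpow_mem_Ioc (B : Set ℂ) {p : ℝ} (hp : 0 ≤ p) : hullDeriv B ^ p ∈ Ioc (0 : ℝ) 1 :=
  ⟨Real.rpow_pos_of_pos (hullDeriv_pos B) p, Real.rpow_le_one (hullDeriv_pos B).le (hullDeriv_le_one B) hp⟩

/-- **`hullDeriv = starDeriv`**: the number `Φ'_B(0)` of this file is the canonical restriction
derivative `starDeriv B` of `StarHullCanonical` (for a `*`-hull both are the unique `d` with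
`HasRestrictionDeriv B Φ_B d`, `HasRestrictionDeriv.eq_starDeriv`; off `𝒬*` both take the junk
value `1`). [folklore] -/
theorem hullDeriv_eq_starDeriv (B : Set ℂ) : hullDeriv B = starDeriv B := by
  by_cases hB : IsStarHull B
  · obtain ⟨Φ, hΦ, hd, -, -⟩ := exists_hasRestrictionDeriv_hullDeriv hB
    exact HasRestrictionDeriv.eq_starDeriv hB hΦ hd
  · rw [hullDeriv_of_not_isStarHull hB, starDeriv, dif_neg hB]

end HullDeriv

namespace SLEKappaRho

/-! ### The functional `M = h'(W)^{5/8} h'(O)^b ((h(W) − h(O))/(W − O))^c` in slid coordinates -/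

/-- The hull `B` seen from the real point `x`: `B − x = {z − x : z ∈ B}` (for `B = A_t − W_t` and
`x = O_t − W_t` this is `A_t − O_t`). [folklore] -/
def translate (B : Set ℂ) (x : ℝ) : Set ℂ := (fun z : ℂ ↦ z - x) '' B

/-- `B − 0 = B`. [folklore] -/
@[simp] theorem translate_zero (B : Set ℂ) : translate B 0 = B := by
  simp [translate]

/-- `∅ − x = ∅`. [folklore] -/
@[simp] theorem translate_empty (x : ℝ) : translate ∅ x = ∅ := image_empty _

/-- **The factor `(h_t(W_t) − h_t(O_t))/(W_t − O_t)` in slid coordinates** (`W_t ↦ 0`,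
`O_t ↦ o = O_t − W_t ≤ 0`, `h_t'(x + W_t) = Φ'_{B−x}(0)` for the slid hull `B = A_t − W_t`): by the
fundamental theorem of calculus it is the average `⨍_{[o,0]} Φ'_{B−x}(0) dx` of `h_t'` over
`[O_t, W_t]` when `o < 0`, and ([LSW]: "when `W_t = O_t`, we take `M_t = h_t'(W_t)^{(5/8)+b+c}`")
`Φ'_B(0)` when `o = 0` (values `o > 0` do not occur, `O_t ≤ W_t`; they get the same convention).
[cite: LawlerSchrammWerner2003Restriction, §8.4 (definition of M_t)] -/
def hullSlope (B : Set ℂ) (o : ℝ) : ℝ :=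
  if o < 0 then (∫ x in o..0, hullDeriv (translate B x)) / (-o) else hullDeriv B

/-- At `o = 0` the slope factor is `h'(W) = Φ'_B(0)`. [folklore] -/
@[simp] theorem hullSlope_zero (B : Set ℂ) : hullSlope B 0 = hullDeriv B := by
  simp [hullSlope]

/-- For `o < 0` the slope factor is the average of `x ↦ Φ'_{B−x}(0)` over `[o, 0]`. [folklore] -/
theorem hullSlope_of_neg (B : Set ℂ) {o : ℝ} (ho : o < 0) :
    hullSlope B o = (∫ x in o..0, hullDeriv (translate B x)) / (-o) := by
  simp [hullSlope, ho]

/-- **[LSW]'s `M_t` as a deterministic functional of the slid hull and of `o = O_t − W_t`**: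
`M = Φ'_B(0)^{5/8} · Φ'_{B−o}(0)^b · (hullSlope B o)^c` with `b = ρ(4 + 3ρ)/32`, `c = 3ρ/8`
(`expB`, `expC`), i.e. `h_t'(W_t)^{5/8} h_t'(O_t)^b [(h_t(W_t) − h_t(O_t))/(W_t − O_t)]^c` for
`B = A_t − W_t`; real powers `Real.rpow` (all three bases are positive before `T_A`, by (8.2)).
[cite: LawlerSchrammWerner2003Restriction, §8.4 (definition of M_t)] -/
def oneSidedM (ρ : ℝ) (B : Set ℂ) (o : ℝ) : ℝ :=
  hullDeriv B ^ (5 / 8 : ℝ) * hullDeriv (translate B o) ^ expB ρ * hullSlope B o ^ expC ρ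

/-- **"When `W_t = O_t`, we take `M_t = h_t'(W_t)^{(5/8)+b+c}`"** — and `5/8 + b + c = α`.
[cite: LawlerSchrammWerner2003Restriction, §8.4 (definition of M_t) and proof of Lemma 8.10 (α = 5/8 + b + c)] -/
theorem oneSidedM_zero (ρ : ℝ) (B : Set ℂ) :
    oneSidedM ρ B 0 = hullDeriv B ^ sleKappaRhoExponent ρ := by
  rw [oneSidedM, translate_zero, hullSlope_zero, ← five_eighths_add_expB_add_expC,
    Real.rpow_add (hullDeriv_pos B), Real.rpow_add (hullDeriv_pos B)]

/-- For the empty hull `M ≡ 1` (`Φ_∅ = id`). [folklore] -/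
theorem oneSidedM_empty (ρ o : ℝ) : oneSidedM ρ ∅ o = 1 := by
  have hslope : hullSlope ∅ o = 1 := by
    by_cases ho : o < 0
    · rw [hullSlope_of_neg _ ho]
      simp only [translate_empty, hullDeriv_empty, intervalIntegral.integral_const, smul_eq_mul,
        mul_one, zero_sub]
      exact div_self (neg_ne_zero.2 ho.ne)
    · simp [hullSlope, ho, hullDeriv_empty]
  simp [oneSidedM, hullDeriv_empty, hslope]

/-! ### The conclusion of Lemma 8.9 with the convergence clause, as a predicate -/

/-- **The martingale extension of `M_t` past `T_A`** — the conclusion of [LSW] Lemma 8.9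
("`(M_t, t < T)` is a local martingale") combined with Lemma 8.10 ("`M_t ≤ 1`") and the
convergence clause of the end of the proof of Thm. 8.4 ("since `M_t` converges a.s. and in `L¹`
when `t → T`"), packaged exactly as the tree packages [LSW] Prop. 5.2/5.3 for SLE_{8/3}
(`IsRestrictionMartingale`, `SLERestrictionMartingale`): `M` is a `[0, 1]`-valued martingale of
the (raw) Brownian filtration `𝓕ᵂ` on the canonical space which, almost surely, equals the
formula `oneSidedM ρ (A_t − W_t) (O_t − W_t)` at every `t < T_A` (`T_A = Loewner.hullHitTime`, the
hitting time of `A` by the closed hulls of `t ↦ W_t(ω)`), is frozen at its left limit from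
`T_A < ∞` on, and converges as `t → ∞` on `{T_A = ∞}` (a bounded local martingale is a
martingale, Revuz–Yor (1999) Ch. IV Prop. (1.23); the a.s. limits by the convergence theorem
for bounded martingales, Ch. II Thm. (2.10)). A predicate on `(ρ, A, O, W, M)`; its existence
statement for SLE(8/3, ρ) pairs and smooth `A ∈ 𝒬₊` is the stochastic-calculus leaf of
`SLEKappaRho.exists_isOneSidedMartingale` (Itô's formula for the random conformal maps `h_t` of
§5 is not in the tree; the algebra of Lemma 8.9 is proved in `SLEKappaRhoMartingaleAlgebra`).
[cite: LawlerSchrammWerner2003Restriction, Lemma 8.9 and end of the proof of Thm. 8.4 (§8.4)] -/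
structure IsMartingaleExtension (ρ : ℝ) (A : Set ℂ) (O W M : ℝ≥0 → (ℝ≥0 → ℝ) → ℝ) : Prop where
  /-- `0 ≤ M_t ≤ 1`. -/
  mem_Icc : ∀ t ω, M t ω ∈ Icc (0 : ℝ) 1
  /-- `M` is an `𝓕ᵂ`-martingale under the pre-Wiener measure. -/
  martingale : Martingale M brownianFiltration preWienerMeasure
  /-- A.s., `M_t = h_t'(W_t)^{5/8} h_t'(O_t)^b [(h_t(W_t) − h_t(O_t))/(W_t − O_t)]^c` before `T_A`. -/
  ae_eq_oneSidedM : ∀ᵐ ω ∂preWienerMeasure, ∀ t : ℝ≥0,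
    (t : WithTop ℝ≥0) < Loewner.hullHitTime (fun s ↦ W s ω) A →
      M t ω = oneSidedM ρ (Loewner.slidHull (fun s ↦ W s ω) A t) (O t ω - W t ω)
  /-- A.s., from the hitting time `T_A < ∞` on, `M` equals its left limit at `T_A`. -/
  ae_frozen : ∀ᵐ ω ∂preWienerMeasure, ∀ τ : ℝ≥0, Loewner.hullHitTime (fun s ↦ W s ω) A = τ →
    ∀ t : ℝ≥0, τ ≤ t → Tendsto (fun s ↦ M s ω) (𝓝[<] τ) (𝓝 (M t ω))
  /-- A.s., if `A` is never hit (`T_A = ∞`), the limit `lim_{t → ∞} M_t` exists. -/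
  ae_exists_tendsto : ∀ᵐ ω ∂preWienerMeasure, Loewner.hullHitTime (fun s ↦ W s ω) A = ⊤ →
    ∃ c : ℝ, Tendsto (fun t ↦ M t ω) atTop (𝓝 c)

/-- **Non-vacuity**: for the empty hull (`T_∅ = ∞`, slid hull `∅`, `M ≡ 1`) the constant process
`1` is a martingale extension, for any `ρ`, `O`, `W`. [folklore] -/
theorem isMartingaleExtension_empty (ρ : ℝ) (O W : ℝ≥0 → (ℝ≥0 → ℝ) → ℝ) :
    IsMartingaleExtension ρ ∅ O W fun _ _ ↦ 1 := by
  haveI : IsProbabilityMeasure preWienerMeasure := isProbabilityMeasure_preWienerMeasure'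
  have htop : ∀ ω, Loewner.hullHitTime (fun s ↦ W s ω) ∅ = ⊤ := fun ω ↦
    Loewner.hullHitTime_eq_top_iff.2 fun t ↦ Set.disjoint_empty _
  refine ⟨fun _ _ ↦ ⟨zero_le_one, le_rfl⟩, martingale_const _ _ _, ?_, ?_, ?_⟩
  · exact Eventually.of_forall fun ω t _ ↦ by rw [Loewner.slidHull_empty, oneSidedM_empty]
  · exact Eventually.of_forall fun ω τ hτ ↦ absurd ((htop ω).symm.trans hτ) WithTop.top_ne_coe
  · exact Eventually.of_forall fun ω _ ↦ ⟨1, tendsto_const_nhds⟩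


end SLEKappaRho

end Literature.Probability.RandomPlanarGeometry

end
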